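import Mathlib
import Literature.MeasureTheory.Radon.CompactClassContent
import Literature.MeasureTheory.Radon.MeasurableRectangleContent
import HarnessLib

/-!
# Extension of a positive bimeasure on Polish spaces to a measure on the product

**Theorem** (bimeasure extension; Marczewski's compact-class argument, cf. [cite: Bogachev2007, Thm. 1.4.3 and §3.10(vi)]).
Let `X, Y` be Polish spaces with their Borel σ-algebras and `λ : Set Y → Measure X` a family of FINITE measures which is a
positive bimeasure: `λ_∅ = 0`, `λ_{B ∪ B'} = λ_B + λ_{B'}` for disjoint measurable `B, B'`, and for every measurable `A ⊆ X`
the set function `B ↦ λ_B(A)` is countably additive on measurable sets.  Then there is a measure `μ` on `X × Y` with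
`μ(A ×ˢ B) = λ_B(A)` for all measurable `A, B` (`exists_measure_prod_eq_bimeasure`).

Proof: the additive content of the bimeasure on the semiring of measurable rectangles (`exists_addContent_bimeasure`),
extended to the generated ring (`AddContent.supClosure`), is inner regular with respect to the compact system of compact
members of the ring — each rectangle `A ×ˢ B` is approximated by `K₁ ×ˢ K₂` with `K₁ ⊆ A` compact for the finite measure
`λ_B` and `K₂ ⊆ B` compact for the finite measure `B ↦ λ_B(K₁)` (Ulam tightness on Polish spaces,
`MeasurableSet.exists_isCompact_sdiff_lt`) — so Marczewski's theorem (`AddContent.exists_measure_eq_of_innerRegular`)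
yields the measure.  THEOREMS ONLY; no `sorry`; standard axioms.  Motivation in the tree: the Laplace–Fourier measure of a
reflection-positive kernel (crux ⟨stmt-QuantumFields-23125⟩, stub `stub_laplaceFourier`).
-/

noncomputable section

open MeasureTheory Set Filter Topology Function
open scoped ENNReal

namespace Literature.MeasureTheory.Radon

variable {X Y : Type*} [TopologicalSpace X] [PolishSpace X] [MeasurableSpace X] [BorelSpace X]
  [TopologicalSpace Y] [PolishSpace Y] [MeasurableSpace Y] [BorelSpace Y]

omit [TopologicalSpace X] [PolishSpace X] [BorelSpace X] [TopologicalSpace Y] [PolishSpace Y] [BorelSpace Y] in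
/-- The measure `B ↦ λ_B(A)` on `Y` attached to a measurable `A ⊆ X` by a countably additive bimeasure. [folklore] -/
private theorem exists_measure_snd (lam : Set Y → Measure X) (h0 : lam ∅ = 0)
    (hσ : ∀ A, MeasurableSet A → ∀ (f : ℕ → Set Y), (∀ i, MeasurableSet (f i)) → Pairwise (Disjoint on f) →
      lam (⋃ i, f i) A = ∑' i, lam (f i) A)
    {A : Set X} (hA : MeasurableSet A) :
    ∃ ν : Measure Y, ∀ B, MeasurableSet B → ν B = lam B A := by
  refine ⟨Measure.ofMeasurable (fun B _ => lam B A) (by rw [h0]; rfl) (fun f hf hdis => hσ A hA f hf hdis),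
    fun B hB => Measure.ofMeasurable_apply B hB⟩

omit [TopologicalSpace X] [PolishSpace X] [BorelSpace X] [TopologicalSpace Y] [PolishSpace Y] [BorelSpace Y] in
/-- The ring generated by the measurable rectangles generates the product σ-algebra. [folklore] -/
private theorem generateFrom_supClosure_prod :
    (Prod.instMeasurableSpace : MeasurableSpace (X × Y)) = MeasurableSpace.generateFrom
      (supClosure (image2 (· ×ˢ ·) {A : Set X | MeasurableSet A} {B : Set Y | MeasurableSet B})) := by
  refine le_antisymm ?_ ?_
  · rw [← generateFrom_prod]
    exact MeasurableSpace.generateFrom_mono subset_supClosure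
  · refine MeasurableSpace.generateFrom_le fun s hs => ?_
    obtain ⟨P, hP⟩ := (isSetSemiring_measurableProd (X := X) (Y := Y)).mem_supClosure_iff.1 hs
    rw [← P.sup_parts, Finset.sup_set_eq_biUnion]
    refine Finset.measurableSet_biUnion _ fun u hu => ?_
    obtain ⟨A, hA, B, hB, rfl⟩ := hP hu
    exact hA.prod hB

/-- **Extension of a positive bimeasure on Polish spaces to a product measure.**  For `λ : Set Y → Measure X` a family of
finite measures with `λ_∅ = 0`, additive on disjoint measurable sets, and `B ↦ λ_B(A)` countably additive for every
measurable `A`, there is a measure `μ` on `X × Y` with `μ(A ×ˢ B) = λ_B(A)` for all measurable `A, B`.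
[cite: Bogachev2007, Thm. 1.4.3] -/
theorem exists_measure_prod_eq_bimeasure (lam : Set Y → Measure X) (hfin : ∀ B, IsFiniteMeasure (lam B))
    (h0 : lam ∅ = 0)
    (hadd : ∀ B B', MeasurableSet B → MeasurableSet B' → Disjoint B B' → lam (B ∪ B') = lam B + lam B')
    (hσ : ∀ A, MeasurableSet A → ∀ (f : ℕ → Set Y), (∀ i, MeasurableSet (f i)) → Pairwise (Disjoint on f) →
      lam (⋃ i, f i) A = ∑' i, lam (f i) A) :
    ∃ μ : Measure (X × Y), ∀ (A : Set X) (B : Set Y), MeasurableSet A → MeasurableSet B → μ (A ×ˢ B) = lam B A := by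
  classical
  set C : Set (Set (X × Y)) := image2 (· ×ˢ ·) {A : Set X | MeasurableSet A} {B : Set Y | MeasurableSet B} with hCdef
  have hC : IsSetSemiring C := isSetSemiring_measurableProd
  obtain ⟨m, hm⟩ := exists_addContent_bimeasure lam h0 hadd
  -- the ring and the extended content
  set R : Set (Set (X × Y)) := supClosure C with hRdef
  have hR : IsSetRing R := hC.isSetRing_supClosure
  set M : AddContent ℝ≥0∞ R := m.supClosure hC with hMdef
  have hMC : ∀ (A : Set X) (B : Set Y), MeasurableSet A → MeasurableSet B → M (A ×ˢ B) = lam B A := by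
    intro A B hA hB
    rw [hMdef, AddContent.supClosure_apply_of_mem hC m ⟨A, hA, B, hB, rfl⟩, hm A B hA hB]
  have hCR : C ⊆ R := subset_supClosure
  -- every ring element is a finite disjoint union of rectangles
  have hdecomp : ∀ s ∈ R, ∃ P : Finpartition s, ↑P.parts ⊆ C := fun s hs => hC.mem_supClosure_iff.1 hs
  -- finiteness
  have hfinR : ∀ s ∈ R, M s ≠ ∞ := by
    intro s hs
    obtain ⟨P, hP⟩ := hdecomp s hs
    rw [hMdef, AddContent.supClosure_apply_finpartition hC m hP]
    refine ENNReal.sum_ne_top.2 fun u hu => ?_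
    obtain ⟨A, hA, B, hB, rfl⟩ := hP hu
    rw [hm A B hA hB]
    haveI := hfin B
    exact measure_ne_top _ _
  -- the compact system of compact ring elements
  set K : Set (Set (X × Y)) := {s | s ∈ R ∧ IsCompact s} with hKdef
  have hK : IsCompactSystem K := (isCompactSystem_isCompact (X × Y)).mono fun s hs => hs.2
  have hKR : K ⊆ R := fun s hs => hs.1
  -- inner regularity of one rectangle
  have hrect : ∀ (A : Set X) (B : Set Y), MeasurableSet A → MeasurableSet B → ∀ δ : ℝ≥0∞, 0 < δ →
      ∃ k ∈ K, k ⊆ A ×ˢ B ∧ M ((A ×ˢ B) \ k) ≤ δ := by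
    intro A B hA hB δ hδ
    haveI := hfin B
    have hδ2 : δ / 2 ≠ 0 := (ENNReal.half_pos hδ.ne').ne'
    obtain ⟨K₁, hK₁A, hK₁c, hK₁⟩ := hA.exists_isCompact_sdiff_lt (measure_ne_top (lam B) A) hδ2
    have hK₁m : MeasurableSet K₁ := hK₁c.measurableSet
    obtain ⟨ν, hν⟩ := exists_measure_snd lam h0 hσ hK₁m
    haveI : IsFiniteMeasure ν := by
      refine ⟨?_⟩
      rw [hν univ MeasurableSet.univ]
      haveI := hfin (univ : Set Y)
      exact measure_lt_top _ _
    obtain ⟨K₂, hK₂B, hK₂c, hK₂⟩ := hB.exists_isCompact_sdiff_lt (measure_ne_top ν B) hδ2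
    have hK₂m : MeasurableSet K₂ := hK₂c.measurableSet
    rw [hν _ (hB.diff hK₂m)] at hK₂
    refine ⟨K₁ ×ˢ K₂, ⟨hCR ⟨K₁, hK₁m, K₂, hK₂m, rfl⟩, hK₁c.prod hK₂c⟩, prod_mono hK₁A hK₂B, ?_⟩
    -- `(A × B) \ (K₁ × K₂) = (A \ K₁) × B ∪ K₁ × (B \ K₂)`
    have hsplit : (A ×ˢ B) \ (K₁ ×ˢ K₂) = ((A \ K₁) ×ˢ B) ∪ (K₁ ×ˢ (B \ K₂)) := by
      ext ⟨x, y⟩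
      have hxA := @hK₁A x
      simp only [Set.mem_sdiff, Set.mem_prod, Set.mem_union]
      tauto
    have h1 : (A \ K₁) ×ˢ B ∈ R := hCR ⟨_, hA.diff hK₁m, _, hB, rfl⟩
    have h2 : K₁ ×ˢ (B \ K₂) ∈ R := hCR ⟨_, hK₁m, _, hB.diff hK₂m, rfl⟩
    rw [hsplit]
    calc M ((A \ K₁) ×ˢ B ∪ K₁ ×ˢ (B \ K₂)) ≤ M ((A \ K₁) ×ˢ B) + M (K₁ ×ˢ (B \ K₂)) :=
          addContent_union_le hR h1 h2
      _ = lam B (A \ K₁) + lam (B \ K₂) K₁ := by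
          rw [hMC _ _ (hA.diff hK₁m) hB, hMC _ _ hK₁m (hB.diff hK₂m)]
      _ ≤ δ / 2 + δ / 2 := add_le_add hK₁.le hK₂.le
      _ = δ := ENNReal.add_halves δ
  -- inner regularity of the ring elements
  have hreg : ∀ s ∈ R, ∀ ε : ℝ≥0∞, 0 < ε → ∃ k ∈ K, k ⊆ s ∧ M (s \ k) ≤ ε := by
    intro s hs ε hε
    obtain ⟨P, hP⟩ := hdecomp s hs
    obtain ⟨δ, hδpos, hδsum⟩ := ENNReal.exists_pos_sum_of_countable hε.ne' P.parts
    -- compact approximants of the parts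
    have hparts : ∀ u : P.parts, ∃ k ∈ K, k ⊆ (u : Set (X × Y)) ∧ M (u \ k) ≤ δ u := by
      intro u
      obtain ⟨A, hA, B, hB, hu⟩ := hP u.2
      obtain ⟨k, hk, hku, hkM⟩ := hrect A B hA hB (δ u) (ENNReal.coe_pos.2 (hδpos u))
      exact ⟨k, hk, hu ▸ hku, hu ▸ hkM⟩
    choose k hkK hku hkM using hparts
    have hdiffR : ∀ u : P.parts, (u : Set (X × Y)) \ k u ∈ R := fun u =>
      hR.sdiff_mem (hCR (hP u.2)) (hKR (hkK u))
    have hcover : s \ (⋃ u ∈ (Finset.univ : Finset P.parts), k u) ⊆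
        ⋃ u ∈ (Finset.univ : Finset P.parts), ((u : Set (X × Y)) \ k u) := by
      intro x hx
      have hxs : x ∈ s := hx.1
      rw [← P.sup_parts, Finset.sup_set_eq_biUnion] at hxs
      obtain ⟨u, hu, hxu⟩ := mem_iUnion₂.1 hxs
      refine mem_iUnion₂.2 ⟨⟨u, hu⟩, Finset.mem_univ _, hxu, fun hxk => hx.2 ?_⟩
      exact mem_iUnion₂.2 ⟨⟨u, hu⟩, Finset.mem_univ _, hxk⟩
    refine ⟨⋃ u ∈ (Finset.univ : Finset P.parts), k u,
      ⟨hR.biUnion_mem Finset.univ (fun u _ => hKR (hkK u)), Finset.univ.isCompact_biUnion fun u _ => (hkK u).2⟩,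
      ?_, ?_⟩
    · exact iUnion₂_subset fun u _ => (hku u).trans (P.le u.2)
    · calc M (s \ ⋃ u ∈ (Finset.univ : Finset P.parts), k u)
          ≤ M (⋃ u ∈ (Finset.univ : Finset P.parts), ((u : Set (X × Y)) \ k u)) :=
            addContent_mono hR.isSetSemiring (hR.sdiff_mem hs (hR.biUnion_mem Finset.univ fun u _ => hKR (hkK u)))
              (hR.biUnion_mem Finset.univ fun u _ => hdiffR u) hcover
        _ ≤ ∑ u ∈ (Finset.univ : Finset P.parts), M ((u : Set (X × Y)) \ k u) :=
            addContent_biUnion_le hR fun u _ => hdiffR u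
        _ ≤ ∑ u ∈ (Finset.univ : Finset P.parts), (δ u : ℝ≥0∞) := Finset.sum_le_sum fun u _ => hkM u
        _ ≤ ∑' u, (δ u : ℝ≥0∞) := ENNReal.sum_le_tsum _
        _ ≤ ε := hδsum.le
  -- Marczewski + Carathéodory
  obtain ⟨μ, hμ⟩ := AddContent.exists_measure_eq_of_innerRegular hR M hfinR hK hKR hreg generateFrom_supClosure_prod
  exact ⟨μ, fun A B hA hB => by rw [hμ _ (hCR ⟨A, hA, B, hB, rfl⟩), hMC A B hA hB]⟩

end Literature.MeasureTheory.Radon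

end
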